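import Mathlib
import Summits.Ventures.FusionMHD.Models.CerfonFreidbergIterLikeQHalfMercDefs
import HarnessLib

/-!
# Ventures/FusionMHD — Models/CerfonFreidbergIterLikeQHalfMercPanels12.lean: KERNEL CHECK of the Mercier-register certificates of panel(s) 20, 21 (of 32)
# at `ψ_N = 1/2` of THE Cerfon–Freidberg ITER-like instance

HONEST FRAMING (LADDER-GRIDFUSION three columns; CF rung; «F2.R2-CF-MERCIER-IMPLICIT» step (2), F2-SCOPING v1.6 §10(c)).  One `decide +kernel` (≈ 100 s): for each
listed panel the obligation `CFIterLike.QHalfMerc.MercCert.ok` (`Models/CerfonFreidbergIterLikeQHalfMercDefs.lean`) — the Taylor-model run of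
`progM = progA ++ block1 ++ block2 ++ block3M` over ★ #117's parameter box is ACCEPTED (both `inv` certificates included) and the kernel's FOUR panel-integral
enclosures (`g_W`, `g_Aσ`, `g_AR`, `g_B1` along the approximant) lie inside the claimed integers (read off a compiled `#eval` of the same functions, slack one unit of
`2⁻⁶⁰`; float truth inside every panel, `HOME/models/model-7/g7/genqm/truthM.json`).  MODELLED: analytic Cerfon–Freidberg family; nothing about a device or
stability.  No `native_decide`.  Typer/prover: gridfusion-model-7 (g7), 2026-08-27.
Citations: Jardin 2010 §8.5 (8.134) [Jardin2010]; Mahboubi–Melquiond–Sibut-Pinote 2016 §3.2 Lemma 3 [MahboubiMelquiondSibutpinote2016].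
-/

namespace Summit.Ventures.FusionMHD.Models.CFIterLike.QHalfMerc

/-- Mercier-register certificate data of panel(s) 20, 21. [instance data] -/
def mercCert12 : List MercCert := [
  { j := 20, cand1 := [2424349227180785401856, -196284790322105122816, -137867208690581423259648, 416106526991708699230208, 6608366222417812420296704, -43692269244617943708336128, -221179392526530937282887680, 3074297096162013221708890112, 1712645154905256230014418944, -168333182894492744892561752064, 471106307330154685535262605312, 7036072096146430224096890454016, -47676739070391441228185062080512],
    cand2 := [1928046183433359851520, -8148862520329671540736, -82145970070296350162944, 1446408728013690349027328, -4864932821315683440656384, -89651991212355281668276224, 1215570738182505283530522624, -2348637304643702543815278592, -90433885744051322454093594624, 999171490861738898897986650112, -410468881992834359924789084160, -86502979642674079969584592453632, 732100927863701083446273315438592],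
    deg := 10, e1 := 46, e2 := 46, wlo := 6246042252945726306, whi := 6246042824832146151, slo := 53949737321361706612, shi := 53949741698181495119,
    rlo := 42989697008392477290, rhi := 42989700648965785195, blo := 67724015213765309345, bhi := 67724020520886339588 },
  { j := 21, cand1 := [2301158872597040726016, -7015879337143586258944, -74814379303953869307904, 775173900534555273592832, -554890573017078061596672, -33982529412179354347110400, 215669309240873267700432896, 374861845287926608227729408, -12043462576824666614631759872, 50524755420866793836835241984, 261444712758227413636772528128, -3675136348363688749146151321600, 10210917063738529452331546705920],
    cand2 := [1631010797761913421824, -9878365401535125389312, 12087694951035676131328, 543620175462483231768576, -6452778398677392661938176, 31361948010683369080750080, 101105710600729297170726912, -3153807288840002037035827200, 26483270072728862142603722752, -68821889097044661649146904576, -1049060014108826245737234825216, 15586399322092121845727143919616, -84889790511473208509644973015040],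
    deg := 10, e1 := 46, e2 := 46, wlo := 5468497584384904599, whi := 5468498108702007038, slo := 41712816687853882978, shi := 41712820595563428971,
    rlo := 31497258788146483003, rhi := 31497261840151823258, blo := 55252167921829133907, bhi := 55252172932541791882 }]

/-- **KERNEL CHECK** of the four Mercier registers on panel(s) 20, 21. -/
theorem mercCert12_ok : CFIterLike.QHalfMerc.mercCert12.all MercCert.ok = true := by
  decide +kernel

end Summit.Ventures.FusionMHD.Models.CFIterLike.QHalfMerc
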